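import Literature.Computability.Complexity.OracleAlgEnumeration
import Literature.Computability.Complexity.ComputableRealProofs
import Literature.Computability.Cryptography.QuantumTuringMachine
import HarnessLib

/-!
# Polynomial-time computable reals are computable reals — proof

Sibling proof file of `QuantumTuringMachine.lean` (D-0014: the named fact there stays a `def`;
this file discharges it):

* `IsPolyTimeComputableReal.isComputableReal_holds : IsPolyTimeComputableReal.isComputableReal` —
  a real number with a polynomial-time computable dyadic name (Ko 1991, Def. 2.1; in the tree
  `IsPolyTimeComputableReal x`: some `f : ℕ → ℤ`, computed by a `TM2` machine from `1ⁿ` in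
  polynomial time, with `|x - f n / 2ⁿ| ≤ 2⁻ⁿ`) is a computable real in the sense of
  `Literature.Computability.Complexity.IsComputableReal` (Turing 1936; Weihrauch 2000,
  Def. 4.1.13: a `Computable` fast Cauchy name `g : ℕ → ℚ`, `|x - g n| ≤ 2⁻ⁿ`).

## The printed argument, as formalised

Ko–Friedman 1982, §3 (p. 333) define the time complexity of a real number as the running time of
a Turing machine computing, on input `n` in unary, an `n`-bit dyadic approximation; a
polynomial-time computable real is by definition a *recursive* real number with a polynomial
time bound ("we will use the concept of complexity of Turing machines to define the complexity of
recursive real numbers"; Ko 1991, Def. 2.1 and §2.1). In the tree the two notions live in two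
different models of computation — Mathlib's stack machines `Turing.FinTM2` (`PolyTimeComputable`,
`TimeBounds.lean`) for the polynomial-time side and Mathlib's partial recursive functions
(`Computable`, `Primrec`) for `IsComputableReal` — so the content of the proof is the simulation
of `TM2` machines by primitive recursive functions. That simulation is already in the tree:
`PolyTimeCountable.lean` compiles every bundled machine into a standard machine
(`TM2Std.outputs_tr`) and `UniversalTM2.lean` interprets standard machines primitive recursively
(`UnivTM2.urun`, `UnivTM2.primrec_urun`, `UnivTM2.urun_of_outputsInTime`); `OracleAlgEnumeration.lean`
supplies the coded initial configuration, the output reader and the clock (`UnivTM2.initCfg`,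
`UnivTM2.outBits`, `UnivTM2.clockFn`, `UnivTM2.idxOf`). We assemble them (Arora–Barak 2009, §1.4,
universal simulation):

1. `UnivTM2.outBits_urun_idxOf` — running the interpreter with the index data of a machine `T`
   on an input word `w` for `c · |w| ^ d + c ≥` (halting time) steps and reading the output stack
   returns `T`'s output word (the computation of `UnivTM2.ustepFn_idxOf`, for a bare input word);
2. `PolyTimeComputable.exists_primrec` — hence every `PolyTimeComputable ea eb f` over the
   alphabet `Bool` has a primitive recursive string function `F` with `F (ea a) = eb (f a)`;
   with a primitive recursive input coding, `a ↦ eb (f a)` is primitive recursive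
   (`PolyTimeComputable.primrec_encode`, `PolyTimeComputable.primrec_encode_unary`);
3. decoding: the word `encodingIntBool.encode z = s ∷ s ∷ 0 ∷ 1 ∷ encodeNat |z|` (`s` the sign
   bit) is read back as the rational `± |z| / 2ⁿ` by a primitive recursive function
   (`primrec_bitsToNat`, `primrec_intWordDyadic`; rational arithmetic on codes from
   `ComputableRealProofs.lean`: `rat_natDivTwoPow_primrec`, `rat_neg_primrec`);
4. `IsPolyTimeComputableReal.computable_dyadicName` — so `n ↦ f n / 2ⁿ : ℚ` is `Computable`, and
   it is a fast Cauchy name of `x` with the same error `2⁻ⁿ`.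

Everything here is proved; no definition and no named fact is introduced.

## References

* K.-I. Ko, H. Friedman, *Computational complexity of real functions*, Theoret. Comput. Sci. 20
  (1982) 323–352, §3 (time complexity of recursive real numbers, p. 333) [KoFriedman1982].
* K.-I. Ko, *Complexity Theory of Real Functions*, Birkhäuser 1991, Def. 2.1, §2.1 [Ko1991].
* K. Weihrauch, *Computable Analysis*, Springer 2000, Def. 4.1.13, Lemma 4.2.1 [Weihrauch2000].
* S. Arora, B. Barak, *Computational Complexity: A Modern Approach*, CUP 2009, §1.4 (machines as
  strings, universal simulation) [AroraBarakCC2009].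
-/

namespace Literature.Computability.Complexity

namespace UnivTM2

open _root_.Computability Encodable Turing TM2Std Function

/-- **The interpreter reproduces the output word of a machine.** If the machine `T` (Boolean
input and output alphabets) outputs `y` on `w` within `m ≤ c · |w| ^ d + c` steps, then running
the primitive recursive interpreter `urun` with the index data `idxOf T c d` on the coded initial
configuration of `w` for `clockFn c d |w| = c · |w| ^ d + c` steps and reading the output stack
(`outBits`) returns `y`. (The computation inside `ustepFn_idxOf`, for a bare input word.)
[cite: AroraBarakCC2009, §1.4 (universal simulation)] -/
theorem outBits_urun_idxOf (T : TM2ComputableAux Bool Bool) (cc dd : ℕ) (w y : List Bool) {m : ℕ}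
    (h : T.OutputsWithin w y m) (hm : m ≤ cc * w.length ^ dd + cc) :
    outBits (idxOf T cc dd) (urun (idxOf T cc dd).prog (initCfg (idxOf T cc dd) w)
      (clockFn cc dd w.length)) = y := by
  obtain ⟨h1, h2⟩ := TM2Std.outputs_tr T.tm h
  have key := urun_of_outputsInTime (TM2Std.stdCode T.tm) h1 (m' := clockFn cc dd w.length)
    (by rw [clockFn_eq]; exact hm)
  -- the coded input word is the one `initCfg` prepares
  have hin : (TM2Std.stkCode T.tm T.tm.k₀ (w.map T.inputAlphabet.symm)).map Fin.val =
      w.map (inpCode (idxOf T cc dd).io) := by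
    simp only [TM2Std.stkCode, List.map_map]
    refine List.map_congr_left fun b _ => ?_
    cases b <;> rfl
  change outBits (idxOf T cc dd) (urun (encProg (TM2Std.stdCode T.tm))
    (some ((TM2Std.stdCode T.tm).main : ℕ), ((TM2Std.stdCode T.tm).init : ℕ),
      (List.replicate (TM2Std.stdCode T.tm).nK []).set (TM2Std.stdCode T.tm).k₀
        (w.map (inpCode (idxOf T cc dd).io)))
    (clockFn cc dd w.length)) = y
  rw [← hin, key]
  unfold outBits
  change (((List.replicate (TM2Std.stdCode T.tm).nK ([] : List ℕ)).set (TM2Std.stdCode T.tm).k₁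
      ((TM2Std.stkCode T.tm T.tm.k₁ (y.map T.outputAlphabet.symm)).map Fin.val)).getD
        (TM2Std.stdCode T.tm).k₁ []).map (fun j => (idxOf T cc dd).outTab.getD j false) = y
  rw [getD_set_replicate]
  simp only [TM2Std.stkCode, List.map_map]
  conv_rhs => rw [← List.map_id y]
  refine List.map_congr_left fun b hb => ?_
  have hallowed := h2 (T.outputAlphabet.symm b) (List.mem_map.2 ⟨b, hb, rfl⟩)
  change (List.ofFn fun j : Fin (TM2Std.stdN T.tm + 1) =>
      ((TM2Std.decOpt T.tm T.tm.k₁ (some j)).map T.outputAlphabet).getD false).getD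
        (TM2Std.enc T.tm ⟨T.tm.k₁, T.outputAlphabet.symm b⟩ : ℕ) false = b
  rw [getD_ofFn, TM2Std.decOpt_enc T.tm hallowed]
  simp

/-- The clocked run `(D, w) ↦ outBits D (urun D.prog (initCfg D w) (clockFn D.cc D.dd |w|))` is
primitive recursive (jointly in the index data and the input word).
[cite: AroraBarakCC2009, §1.4 (universal simulation)] -/
theorem primrec_outBits_urun : Primrec (fun p : Idx × List Bool =>
    outBits p.1 (urun p.1.prog (initCfg p.1 p.2) (clockFn p.1.cc p.1.dd p.2.length))) := by
  refine primrec_outBits.comp Primrec.fst ?_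
  exact primrec_urun (Idx.primrec_prog.comp Primrec.fst) (primrec_initCfg.comp Primrec.fst Primrec.snd)
    (primrec_clockFn (Idx.primrec_cc.comp Primrec.fst) (Idx.primrec_dd.comp Primrec.fst)
      (Primrec.list_length.comp Primrec.snd))

end UnivTM2

/-! ### From `TM2` polynomial time to primitive recursion -/

section Bridge

open _root_.Computability

variable {α β : Type}

/-- **Polynomial-time computable functions are primitive recursive on codes.** If `f : α → β`
is computed by a `TM2` machine in polynomial time with respect to Boolean encoders `ea`, `eb`
(`PolyTimeComputable ea eb f`), then some primitive recursive (Mathlib `Primrec`) string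
function `F : List Bool → List Bool` satisfies `F (ea a) = eb (f a)` for every `a` — the clocked
universal simulation of the machine. [cite: AroraBarakCC2009, §1.4 (universal simulation)] -/
theorem PolyTimeComputable.exists_primrec {ea : α → List Bool} {eb : β → List Bool} {f : α → β}
    (hf : PolyTimeComputable ea eb f) :
    ∃ F : List Bool → List Bool, Primrec F ∧ ∀ a, F (ea a) = eb (f a) := by
  obtain ⟨p, T, hT⟩ := hf
  obtain ⟨cc, dd, hcd⟩ := exists_eval_le_mul_pow_add p
  refine ⟨fun w => UnivTM2.outBits (UnivTM2.idxOf T cc dd) (UnivTM2.urun (UnivTM2.idxOf T cc dd).prog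
      (UnivTM2.initCfg (UnivTM2.idxOf T cc dd) w)
      (UnivTM2.clockFn (UnivTM2.idxOf T cc dd).cc (UnivTM2.idxOf T cc dd).dd w.length)),
    UnivTM2.primrec_outBits_urun.comp ((Primrec.const _).pair Primrec.id), fun a => ?_⟩
  exact UnivTM2.outBits_urun_idxOf T cc dd (ea a) (eb (f a)) (hT a) (hcd _)

/-- With a primitive recursive input coding `ea` (on a `Primcodable` type), the output code
`a ↦ eb (f a)` of a polynomial-time computable `f` is primitive recursive.
[cite: AroraBarakCC2009, §1.4 (universal simulation)] -/
theorem PolyTimeComputable.primrec_encode [Primcodable α] {ea : α → List Bool} {eb : β → List Bool}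
    {f : α → β} (hf : PolyTimeComputable ea eb f) (hea : Primrec ea) :
    Primrec fun a => eb (f a) := by
  obtain ⟨F, hF, hFf⟩ := hf.exists_primrec
  exact (hF.comp hea).of_eq fun a => hFf a

/-- Unary inputs: for `f : ℕ → β` computed in polynomial time from `1ⁿ` (`unaryEncodeNat`), the
output code `n ↦ eb (f n)` is primitive recursive. [cite: KoFriedman1982, §3 (inputs `n` in unary, outputs in binary)] -/
theorem PolyTimeComputable.primrec_encode_unary {eb : β → List Bool} {f : ℕ → β}
    (hf : PolyTimeComputable unaryEncodeNat eb f) : Primrec fun n => eb (f n) :=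
  hf.primrec_encode UnivTM2.primrec_unaryEncodeNat

end Bridge

/-! ### Decoding integer words into dyadic rationals -/

section Decode

open _root_.Computability

/-- `bitsToNat` as a right fold. [folklore] -/
private theorem bitsToNat_eq_foldr (l : List Bool) :
    bitsToNat l = l.foldr (fun b s => b.toNat + 2 * s) 0 := by
  induction l with
  | nil => rfl
  | cons b l ih => rw [bitsToNat_cons, List.foldr_cons, ih]

/-- The little-endian binary value `bitsToNat : List Bool → ℕ` is primitive recursive.
[cite: AroraBarakCC2009, §1.4 (universal simulation)] -/
theorem primrec_bitsToNat : Primrec bitsToNat := by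
  have h : Primrec (fun l : List Bool => l.foldr (fun b s => b.toNat + 2 * s) 0) :=
    Primrec.list_foldr Primrec.id (Primrec.const 0)
      ((Primrec.nat_add.comp ((Primrec.dom_bool Bool.toNat).comp (Primrec.fst.comp Primrec.snd))
        (Primrec.nat_mul.comp (Primrec.const 2) (Primrec.snd.comp Primrec.snd))).to₂)
  exact h.of_eq fun l => (bitsToNat_eq_foldr l).symm

/-- Reading an integer word `s ∷ s ∷ 0 ∷ 1 ∷ encodeNat k` (the shape of `encodingIntBool.encode`)
as the dyadic rational `± k / 2ⁿ` is primitive recursive in the word and `n` (for Mathlib's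
`Primcodable ℚ`, via `rat_natDivTwoPow_primrec` and `rat_neg_primrec`).
[cite: KoFriedman1982, §3 (dyadic outputs in binary)] -/
theorem primrec_intWordDyadic : Primrec₂ (fun (w : List Bool) (n : ℕ) =>
    bif w.headI then -((bitsToNat w.tail.tail.tail.tail : ℚ) / 2 ^ n)
    else (bitsToNat w.tail.tail.tail.tail : ℚ) / 2 ^ n) := by
  have htl : Primrec (fun w : List Bool => w.tail.tail.tail.tail) :=
    Primrec.list_tail.comp (Primrec.list_tail.comp (Primrec.list_tail.comp Primrec.list_tail))
  have hmag : Primrec (fun p : List Bool × ℕ => (bitsToNat p.1.tail.tail.tail.tail : ℚ) / 2 ^ p.2) :=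
    rat_natDivTwoPow_primrec.comp (primrec_bitsToNat.comp (htl.comp Primrec.fst)) Primrec.snd
  exact Primrec₂.mk (Primrec.cond (Primrec.list_headI.comp Primrec.fst) (rat_neg_primrec.comp hmag) hmag)

/-- The dyadic reading of `encodingIntBool.encode z` at precision `n` is `z / 2ⁿ`.
[cite: KoFriedman1982, §3 (dyadic outputs in binary)] -/
theorem intWordDyadic_encode (z : ℤ) (n : ℕ) :
    (bif (encodingIntBool.encode z).headI then
        -((bitsToNat (encodingIntBool.encode z).tail.tail.tail.tail : ℚ) / 2 ^ n)
      else (bitsToNat (encodingIntBool.encode z).tail.tail.tail.tail : ℚ) / 2 ^ n) = (z : ℚ) / 2 ^ n := by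
  have hw : encodingIntBool.encode z =
      decide (z < 0) :: decide (z < 0) :: false :: true :: encodeNat z.natAbs := rfl
  rw [hw]
  simp only [List.headI_cons, List.tail_cons, bitsToNat_encodeNat]
  by_cases hz : z < 0
  · simp only [hz, decide_true, cond_true]
    have h' : ((z.natAbs : ℕ) : ℤ) = -z := Int.ofNat_natAbs_of_nonpos hz.le
    have h : ((z.natAbs : ℕ) : ℚ) = -(z : ℚ) := by rw [← Int.cast_natCast, h', Int.cast_neg]
    rw [h, neg_div, neg_neg]
  · simp only [hz, decide_false, cond_false]
    have h' : ((z.natAbs : ℕ) : ℤ) = z := Int.natAbs_of_nonneg (not_lt.mp hz)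
    have h : ((z.natAbs : ℕ) : ℚ) = (z : ℚ) := by rw [← Int.cast_natCast, h']
    rw [h]

end Decode

end Literature.Computability.Complexity

namespace Literature.Computability.Cryptography

open _root_.Computability Complexity

/-- The dyadic name of a polynomial-time computable real is a computable sequence of rationals:
if `f : ℕ → ℤ` is computed in polynomial time from `1ⁿ` (output `encodingIntBool`), then
`n ↦ f n / 2ⁿ : ℚ` is `Computable` (indeed primitive recursive).
[cite: KoFriedman1982, §3 (time complexity of recursive real numbers, p. 333)] -/
theorem IsPolyTimeComputableReal.computable_dyadicName {f : ℕ → ℤ}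
    (hf : PolyTimeComputable unaryEncodeNat encodingIntBool.encode f) :
    Computable fun n : ℕ => (f n : ℚ) / 2 ^ n := by
  have h : Primrec (fun n : ℕ =>
      bif (encodingIntBool.encode (f n)).headI then
        -((bitsToNat (encodingIntBool.encode (f n)).tail.tail.tail.tail : ℚ) / 2 ^ n)
      else (bitsToNat (encodingIntBool.encode (f n)).tail.tail.tail.tail : ℚ) / 2 ^ n) :=
    primrec_intWordDyadic.comp hf.primrec_encode_unary Primrec.id
  exact (h.of_eq fun n => intWordDyadic_encode (f n) n).to_comp

/-- **Discharge of `IsPolyTimeComputableReal.isComputableReal`** (Ko–Friedman 1982, §3; Ko 1991,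
Def. 2.1 / §2.1: a polynomial-time computable real number is a recursive real number): the
polynomial-time dyadic name `n ↦ f n / 2ⁿ` is a `Computable` fast Cauchy name with the same error
`2⁻ⁿ`, the machine being simulated by primitive recursive functions
(`PolyTimeComputable.exists_primrec`). [cite: KoFriedman1982, §3 (time complexity of recursive real numbers, p. 333)] [cite: Ko1991, Def. 2.1] -/
theorem IsPolyTimeComputableReal.isComputableReal_holds : IsPolyTimeComputableReal.isComputableReal := by
  intro x hx
  obtain ⟨f, hf, hfx⟩ := hx
  refine ⟨fun n => (f n : ℚ) / 2 ^ n, IsPolyTimeComputableReal.computable_dyadicName hf, fun n => ?_⟩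
  have h : (((f n : ℚ) / 2 ^ n : ℚ) : ℝ) = (f n : ℝ) / 2 ^ n := by push_cast; rfl
  rw [h]
  exact hfx n

end Literature.Computability.Cryptography
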